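import Summits.BirchSwinnertonDyer.BirchSwinnertonDyer.Theorems.GenusKolyvaginAtTwoPowDvdShaCardAtTwoRTTransverseIsotropicValues
import Summits.BirchSwinnertonDyer.Rank1Residual.X11b.BDPRouteRelaxation
import HarnessLib

/-!
# Route `GenusKolyvaginAtTwo`, crux L_T `PowDvdShaCardAtTwoRT` (stmt-BirchSwinnertonDyer-23242), LINE 18/19 stub 3a⁗, step (b) input I7 —
# the `invWeilPairing` forms (the `hS`-shape of gk2-p4's two-place reciprocity `invWeilPairing_add_eq_zero_of_forall_ne`)

Seat `bsd-line-gk2-p3` g19 (cell `bsd-f1-sign2`), `--supports 23242 --as helper`. One-line translations of `…RTTransverseIsotropic` /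
`…RTTransverseIsotropicValues` into X11b's `invWeilPairing W n e … inv v` (`= inv_v ∘ ∪_{e,v}`, `invWeilPairing_apply`), i.e. exactly the local
terms of `sum_inv_weilCupProduct_localization_eq_zero` as consumed by `…RTTwoPlaceReciprocity` (gk2-p4) and by the swap engines (LEAD gk2-p1,
gk2-p2). With these, the OWN-PRIME terms of McCallum's (13) vanish BY NAME in the two-place reciprocity WITHOUT any self-dual Selmer
structure at the own primes (so the `h𝒯sd` input of `…SwapTwoTermReciprocity.localTatePairing_add_eq_zero_of_swap` — the Lagrangian property
of the full two-dimensional `im χ_ℓ` over `K_λ`, i.e. the Hilbert symbol `(ℓ, −1)_{λ,2^M} = 1` — is NOT needed on this road). THEOREMS ONLY.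
BSD is not proved by any of this; neither is the crux.

* `invWeilPairing_localization_eq_zero_of_h1Eval_mem` — any number field; values of both chosen cocycles on `res Γ_{K_v}` in an
  `e`-trivial set `L`.
* `invWeilPairing_localization_eq_zero_of_values_in_line` — the `K_λ` form (Frobenius at the chosen prime fixing `E[n]`; Frobenius value and
  tame values of both classes in a line `ℤ t₀`, `e(t₀,t₀) = 1`).
* `invWeilPairing_localization_eq_zero_of_transverse_of_Δ_neg` — the `ℚ_ℓ` form on `Δ < 0` at a Gross–Kolyvagin prime of depth `M` (`p = 2`),
  both classes transverse.

References: [McCallumLMS1991] §5 Lemma 5.3, proof of Prop. 5.2 (13); [GrossLMS1991] §7 (7.2).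
-/

set_option autoImplicit false
set_option linter.dupNamespace false -- tree convention: `Summit.BirchSwinnertonDyer.BirchSwinnertonDyer.Theorems` (summit = sub-problem)

noncomputable section
open scoped Classical Pointwise
universe u

namespace Summit.BirchSwinnertonDyer.BirchSwinnertonDyer.Theorems.GenusExact.TransverseIsotropy

open WeierstrassCurve NumberField IsDedekindDomain Field Function
open Literature.NumberTheory.EllipticCurves Literature.NumberTheory.GaloisRepresentations
open Literature.NumberTheory.GaloisCohomology
open Summit.BirchSwinnertonDyer.Rank1Residual.X11b.Relaxation

section AnyField

variable {K : Type u} [Field K] [NumberField K] (W : WeierstrassCurve K) {n : ℕ} [NeZero n]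
  (v : HeightOneSpectrum (𝓞 K))
  (e : geomTorsion W n → geomTorsion W n → AlgebraicClosure K)
  (hμ : ∀ S T, e S T ^ n = 1) (hadd₁ : ∀ S₁ S₂ T, e (S₁ + S₂) T = e S₁ T * e S₂ T)
  (hadd₂ : ∀ S T₁ T₂, e S (T₁ + T₂) = e S T₁ * e S T₂)
  (hgal : ∀ (σ : absoluteGaloisGroup K) (S T : geomTorsion W n), σ • e S T = e (σ • S) (σ • T))

/-- **`invWeilPairing`-form of the values-level criterion** (any number field): `⟨loc_v x, loc_v y⟩_v = 0` in `ℤ/n` when the chosen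
cocycles of `x, y` take their values on `res Γ_{K_v}` in an `e`-trivial set `L`. [cite: McCallumLMS1991, §5 Lemma 5.3] -/
theorem invWeilPairing_localization_eq_zero_of_h1Eval_mem (inv : LocalInvariants K n) (L : Set (geomTorsion W (n : ℤ)))
    (hL : ∀ a ∈ L, ∀ b ∈ L, e a b = 1) {x y : galH1Torsion W (n : ℤ)}
    (hx : ∀ g : absoluteGaloisGroup (v.adicCompletion K), h1Eval W (n : ℤ) x (resGal (K := K) (v.adicCompletion K) g) ∈ L)
    (hy : ∀ g : absoluteGaloisGroup (v.adicCompletion K), h1Eval W (n : ℤ) y (resGal (K := K) (v.adicCompletion K) g) ∈ L) :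
    invWeilPairing W n e hμ hadd₁ hadd₂ hgal inv (Sum.inr v)
        (galoisCohomology.localization (W.torsionGaloisModule ((n : ℕ) : ℤ)) (Sum.inr v) 1 x)
        (galoisCohomology.localization (W.torsionGaloisModule ((n : ℕ) : ℤ)) (Sum.inr v) 1 y) = 0 := by
  rw [invWeilPairing_apply]
  exact inv_cupProduct_localization_eq_zero_of_h1Eval_mem W v e hμ hadd₁ hadd₂ hgal inv L hL hx hy

/-- **`invWeilPairing`-form of the `K_λ` criterion**: at a place where an arithmetic Frobenius `F` at the chosen prime FIXES `E[n]`, if `[x,F]`,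
`[y,F]` and all tame values of `x`, `y` lie in a line `ℤ t₀` with `e(t₀,t₀) = 1`, then `⟨loc_v x, loc_v y⟩_v = 0`. (The own-prime terms of the
two-place reciprocity for two same-sign transverse classes over the Heegner field.) [cite: McCallumLMS1991, §5 Lemma 5.3 and proof of Prop. 5.2] -/
theorem invWeilPairing_localization_eq_zero_of_values_in_line (inv : LocalInvariants K n) (halt : ∀ T, e T T = 1)
    {𝔐 : Ideal (HeightOneSpectrum.localAbsIntegers v)} (h𝔐 : 𝔐 ∈ v.localPrimesAbove)
    {F : absoluteGaloisGroup K}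
    (hFrob : IsArithFrobAt (𝓞 K) F (v.primeBelow (closureEmb (K := K) (v.adicCompletion K)) 𝔐))
    (hFfix : F ∈ torsionFixing W (n : ℤ))
    (hopen : IsOpen (torsionFixing W (n : ℤ) : Set (absoluteGaloisGroup K)))
    (t₀ : geomTorsion W (n : ℤ)) {x y : galH1Torsion W (n : ℤ)}
    (hxF : ∃ k : ℤ, h1Eval W (n : ℤ) x F = k • t₀) (hyF : ∃ k : ℤ, h1Eval W (n : ℤ) y F = k • t₀)
    (hxI : ∀ σ ∈ (v.primeBelow (closureEmb (K := K) (v.adicCompletion K)) 𝔐).inertia (absoluteGaloisGroup K),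
      ∃ k : ℤ, h1Eval W (n : ℤ) x σ = k • t₀)
    (hyI : ∀ σ ∈ (v.primeBelow (closureEmb (K := K) (v.adicCompletion K)) 𝔐).inertia (absoluteGaloisGroup K),
      ∃ k : ℤ, h1Eval W (n : ℤ) y σ = k • t₀) :
    invWeilPairing W n e hμ hadd₁ hadd₂ hgal inv (Sum.inr v)
        (galoisCohomology.localization (W.torsionGaloisModule ((n : ℕ) : ℤ)) (Sum.inr v) 1 x)
        (galoisCohomology.localization (W.torsionGaloisModule ((n : ℕ) : ℤ)) (Sum.inr v) 1 y) = 0 := by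
  haveI := absoluteGaloisGroup_compactSpace (Place.Completion (Sum.inr v : Place K))
  rw [invWeilPairing_apply]
  have h := cupProduct_localization_eq_zero_of_values_in_line W v e hμ hadd₁ hadd₂ hgal halt h𝔐 hFrob hFfix hopen t₀
    hxF hyF hxI hyI
  have h' : (weilContPairingLocal W n e hμ hadd₁ hadd₂ hgal (Sum.inr v)).cupProduct
      (galoisCohomology.localization (W.torsionGaloisModule ((n : ℕ) : ℤ)) (Sum.inr v) 1 x)
      (galoisCohomology.localization (W.torsionGaloisModule ((n : ℕ) : ℤ)) (Sum.inr v) 1 y) = 0 := h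
  rw [h']
  exact map_zero _

end AnyField

section Rat

variable {v : HeightOneSpectrum (𝓞 ℚ)} (W : WeierstrassCurve ℚ) [W.IsElliptic]

/-- **`invWeilPairing`-form over `ℚ_ℓ` on `Δ < 0`** (`q = 2^M`, Gross–Kolyvagin prime of depth `M`, both classes transverse at `v`):
`⟨loc_v x, loc_v y⟩_v = 0`. [cite: McCallumLMS1991, §5 Lemma 5.3 and proof of Prop. 5.2] [cite: GrossLMS1991, §3 (3.2)–(3.3)] -/
theorem invWeilPairing_localization_eq_zero_of_transverse_of_Δ_neg (hΔ : W.Δ < 0) {M : ℕ} (hM : 1 ≤ M)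
    {ℓ : ℕ} (hℓ : ℓ.Prime) (hℓ2 : ℓ ≠ 2) (hℓv : (ℓ : 𝓞 ℚ) ∈ v.asIdeal) (hgood : W.HasGoodReductionAt v)
    {K : Type} [Field K] [NumberField K] (hℓM : FrobEqFrobInfty W K (2 ^ M) ℓ)
    (e : geomTorsion W (2 ^ M : ℕ) → geomTorsion W (2 ^ M : ℕ) → AlgebraicClosure ℚ)
    (hμ : ∀ S T, e S T ^ (2 ^ M) = 1) (hadd₁ : ∀ S₁ S₂ T, e (S₁ + S₂) T = e S₁ T * e S₂ T)
    (hadd₂ : ∀ S T₁ T₂, e S (T₁ + T₂) = e S T₁ * e S T₂) (halt : ∀ T, e T T = 1)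
    (hgal : ∀ (σ : absoluteGaloisGroup ℚ) (S T : geomTorsion W (2 ^ M : ℕ)), σ • e S T = e (σ • S) (σ • T))
    (inv : LocalInvariants ℚ (2 ^ M))
    {x y : galH1Torsion W ((2 ^ M : ℕ) : ℤ)}
    (hx : ∀ 𝔓 ∈ v.primesAbove, ∀ F c₀ : absoluteGaloisGroup ℚ, IsArithFrobAt (𝓞 ℚ) F 𝔓 →
      IsComplexConjugation (Rat.castHom ℝ) c₀ → (∀ P : geomTorsion W ((2 ^ M : ℕ) : ℤ), F • P = c₀ • P) →
      ∃ P₁ : geomTorsion W ((2 ^ M : ℕ) : ℤ), h1Eval W _ x F = F • P₁ - P₁)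
    (hy : ∀ 𝔓 ∈ v.primesAbove, ∀ F c₀ : absoluteGaloisGroup ℚ, IsArithFrobAt (𝓞 ℚ) F 𝔓 →
      IsComplexConjugation (Rat.castHom ℝ) c₀ → (∀ P : geomTorsion W ((2 ^ M : ℕ) : ℤ), F • P = c₀ • P) →
      ∃ P₂ : geomTorsion W ((2 ^ M : ℕ) : ℤ), h1Eval W _ y F = F • P₂ - P₂) :
    invWeilPairing W (2 ^ M) e hμ hadd₁ hadd₂ hgal inv (Sum.inr v)
        (galoisCohomology.localization (W.torsionGaloisModule ((2 ^ M : ℕ) : ℤ)) (Sum.inr v) 1 x)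
        (galoisCohomology.localization (W.torsionGaloisModule ((2 ^ M : ℕ) : ℤ)) (Sum.inr v) 1 y) = 0 := by
  rw [invWeilPairing_apply]
  exact inv_cupProduct_localization_eq_zero_of_transverse_of_Δ_neg W hΔ hM hℓ hℓ2 hℓv hgood hℓM e hμ hadd₁ hadd₂ halt hgal inv
    hx hy

end Rat

end Summit.BirchSwinnertonDyer.BirchSwinnertonDyer.Theorems.GenusExact.TransverseIsotropy

end
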